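import Mathlib

/-!
# Dimock 2015 (scalar QED₃), identities (z)/(birthday): the Gaussian normalization factors of the block-spin
recursion TELESCOPE — the one-step determinant identity behind
`𝒵_k(𝒜+𝒵)/𝒵_k(𝒜) = [det G_k(𝒜+𝒵)/det G_k(𝒜)]^{1/2} = Π_{j<k} [det C_j(…)/det C_j(…)]^{1/2}`,
PROVED as finite-dimensional linear algebra (two Schur complements of one block matrix).

CITATION HEADER (cell `pub-balaban`, DIMOCK TEMPLATE lineage; reproduction of PUBLISHED mathematics, [folklore] algebra).
* [cite: Dimock2015ScalarQED3] J. Dimock, *Nonperturbative renormalization of scalar quantum electrodynamics in d=3*,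
  J. Math. Phys. 56 (2015) 102304 = arXiv:1502.02946v2.  TeX line numbers refer to the arXiv source
  (`inputs/files/dimock/src/1502.02946/1502.02946.tex` of the cell).  Lemma 3 \label{second} (L593–657): the k-fold
  composition of the Gaussian block-spin transformations in a background gauge field 𝒜 is again Gaussian with
  «a_k = a(1−L^{−2})/(1−L^{−2k})» and, at the minimum (L630–635, «We compute the value at the minimum using
  Q(𝒜)Q^T(𝒜) = 1 and a_{k+1} = aa_k/(a_k + aL^{−2}) and find (see [Dim11] for details)»),
  (fifty): «(a/2L²)‖Φ_{k+1} − Q(𝒜)Φ_k^{min}(𝒜)‖² + ½a_k‖Φ_k^{min}(𝒜) − Q_k(𝒜)φ‖² = (a_{k+1}/2L²)‖Φ_{k+1} − Q_{k+1}(𝒜)φ‖²»;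
  §2.5 (z) (L789–790): «𝒩_{k+1}𝒵_{k+1}(𝒜) = 𝒩_k N_k 𝒵_k(𝒜_L) 𝒵^f_k(𝒜_L) L^{s_N − s_{N−k−1}}» where
  (route66) 𝒵_k(𝒜) = ∫exp(−½⟨𝒵,(−Δ_𝒜 + a_kQ_k^TQ_k(𝒜))𝒵⟩)D𝒵 and 𝒵^f_k(𝒜) = ∫exp(−½⟨Z,(Δ_k + aL^{−2}Q^TQ(𝒜))Z⟩)DZ,
  Δ_k(𝒜) = a_k − a_k²Q_k^T(𝒜)G_k(𝒜)Q_k(𝒜) [sic: transposes as printed at L714; the typed form a_k − a_k²Q_kG_kQ_k^T as in (swipe) L1390–1391 / D_k = Q_kG_kQ_k^T L4200];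
  §7 (unbirthday)/(birthday) (L4134–4147): «𝒵_k(𝒜+𝒵)/𝒵_k(𝒜) = [det G_k(𝒜+𝒵)/det G_k(𝒜)]^{1/2}» and «from the recursion
  relation (z)» «= Π_{j=0}^{k−1}[det C_j(𝒜_{L^{k−j}}+𝒵_{L^{k−j}})/det C_j(𝒜_{L^{k−j}})]^{1/2}».
* Context (same recursion, A = 0): [cite: Dimock2013] arXiv:1108.1335v2 §2 (the identities of which D5 §2.5
  says «(see [Dim11] for details)»); [cite: King1986] C. King, CMP 102 (1986) (2.15) (normalization Z^ε_k(Ω,A)).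

WHAT IS PROVED (kernel, no hypotheses beyond invertibility; every declaration [folklore]).  Abstract data: a «fine»
index type `n`, a «coarse» type `m`, a «next» type `p`; real matrices `S : Matrix n n ℝ` (the covariant Laplacian
−Δ_𝒜, or any matrix), `Qk : Matrix m n ℝ` (the k-fold averaging Q_k(𝒜)), `Q : Matrix p m ℝ` (the next averaging
Q(𝒜)) with `Q * Qᵀ = 1` (Dimock L395–397 «Q(A)Q^T(A) = I»), weights `a b : ℝ` (a = a_k, b = aL^{−2}).  Write
`A  := S + a • Qkᵀ * Qk` (= G_k(𝒜)⁻¹), `Δ := a • 1 − a^2 • (Qk * A⁻¹ * Qkᵀ)` (= Δ_k(𝒜)), `P := Qᵀ * Q`,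
`A' := S + (a*b/(a+b)) • (Q * Qk)ᵀ * (Q * Qk)` (= G⁰_{k+1}(𝒜)⁻¹ of (lamp) L4238–4243, i.e. −Δ_𝒜 + (a_{k+1}/L²)Q_{k+1}^TQ_{k+1}:
the coefficient a_k b/(a_k + b) is a_{k+1}·L^{−2} with «a_{k+1} = aa_k/(a_k + aL^{−2})» (L630) — (fifty)'s «a_{k+1}/2L²»; the
rescaling (queen2) → (queen3), L641–652, removes the L^{−2}).
* `proj_idem`, `resolvent_proj_mul`/`mul_resolvent_proj`: `P * P = P` and `(a•1 + b•P) * (a⁻¹•(1 − P) + (a+b)⁻¹•P) = 1`.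
* `schur_topLeft`:  `(a•1 + b•P) − (−a•Qk) * A⁻¹ * (−a•Qkᵀ) = Δ + b•P`            (= C_k(𝒜)⁻¹, D5 (min1) L737–742).
* `schur_bottomRight`: `A − (−a•Qkᵀ) * (a•1 + b•P)⁻¹ * (−a•Qk) = A'`              (the composed fine operator, Lemma 3).
* `det_oneStep` (THE IDENTITY):  `det A * det (Δ + b•P) = det (a•1 + b•P) * det A'`  whenever `det A ≠ 0`, `a ≠ 0`,
  `a + b ≠ 0` — both sides are `det` of the block matrix `fromBlocks A (−a•Qkᵀ) (−a•Qk) (a•1 + b•P)`, the Hessian of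
  Dimock's quadratic form ½⟨φ,Sφ⟩ + (a_k/2)‖Φ_k − Q_kφ‖² + (a/2L²)‖Φ_{k+1} − QΦ_k‖² in (φ, Φ_k); integrating φ first gives
  𝒵_k·𝒵^f_k, integrating Φ_k first gives the composed 𝒵_{k+1} — this is (z) without the volume/2π bookkeeping.
* `det_weight`: `det (a•1 + b•P) = a ^ (card m − card p) * (a + b) ^ card p` (Sylvester `det(1 + UV) = det(1 + VU)`), i.e.
  the constant N_k-type factor is background-INDEPENDENT — which is why it cancels in the RATIO (birthday).
* `det_ratio_oneStep`: for two backgrounds (two matrices S₁, S₂ with the same Qk, Q, a, b):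
  `det A₁' / det A₂' = (det A₁ / det A₂) * (det (Δ₁ + b•P) / det (Δ₂ + b•P))` — one factor of (birthday).
* `normalization_telescope`: the k-step bookkeeping: if `r (j+1) = r j * c j` for all `j < k` then `r k = r 0 * Π_{j<k} c j`.
* v1.1 (append-only, 2026-08-19): the INVERSE of the same block matrix in the two Schur orders (`Matrix.invOf_fromBlocks₁₁_eq`
  = `Matrix.invOf_fromBlocks₂₂_eq`) — `blockInv_eq` — gives three more identities at once: top-left = the Woodbury form
  G⁰_{k+1} = G_k + a_k²G_kQ_kᵀC_kQ_kG_k of the composed propagator ([folklore]; NOT a printed display of B4/D1/D5 — abstract-ring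
  sibling `Beta/ScaleTransport.nextProp_eq`), bottom-right = [Balaban1983Decay] B4 p.573 (1.13)/(1.14) written through the
  composed-scale propagator = p.588 (3.6) at Λ = Ω = Dimock (lamp) L4238–4243 = D1 (coin) «C_k = 𝒜_k + a_k²𝒜_kQ_kG⁰_{k+1}Q_k^T𝒜_k»
  (printed), off-diagonal ⇒ **`minimizer_compose`** = Dimock (h) L807–809 (and (sammy) L1613–1617 for
  the gauge field): ℋ_k·H_k = ℋ_{k+1}, i.e. (a•A⁻¹Qkᵀ)(b•C_kQᵀ) = (ab/(a+b))•A′⁻¹(QQk)ᵀ — the Gaussian core of the nesting of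
  minimisers ([Balaban1985UV3] = B10 (52); tree `B10NestedMinimizer` has schematic bookkeeping over named leaves (StepData), no
  Gaussian formula); helper
  `inv_weight_mul_transpose` ((a•1 + b•QᵀQ)⁻¹Qᵀ = (a+b)⁻¹•Qᵀ).
* v1.2 (DOCFIX only, 2026-08-19; hostile XREAD adv1-g25, GAPS C-A30-1, certificate `HOME/b2b-balaban-adv1/XREAD-NormalizationTelescoping.md`):
  TeX locators corrected (L395–397; L630–635; L714 / (swipe) L1390–1391; (min1) L737–742; (z) L789–790; (h) L807–809; (sammy)
  L1613–1617; (birthday) L4134–4147; (lamp) L4238–4243) and the coefficient identification stated correctly: with b = aL^{−2},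
  a_k b/(a_k + b) = a_{k+1}·L^{−2} (NOT a_{k+1}; the rescaling (queen3) removes the L^{−2}); the v1.1 section docstring now names the
  actual declaration `blockInv_eq` (three conjuncts).  No declaration, statement or proof changed (Lean carries `a*b/(a+b)` literally).
* v1.3 (append-only): `card_le_of_mul_transpose_eq_one` (Q Qᵀ = 1 ⇒ card p ≤ card m, by rank), `det_weight'` (= `det_weight`
  without the cardinality hypothesis), `det_weight_ne_zero`.
* v1.4 (DOCFIX only; hostile XREAD ref6-g15, REFEREE6.md E83 / GAPS C-ref6-83, violation V1 + advisories A1/A2): the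
  display formerly printed here inside «» and attributed to B4 p.588 (3.6)/(3.9) for conjunct 1 (G′ = G + a²GQkᵀCQkG) is NOT
  printed there — (3.6) is conjunct 3's shape (C through the composed-scale G), (3.9) a resolvent difference; the «» and the
  unchecked King-(2.17) pointer are withdrawn, conjunct 1 is labelled [folklore] Woodbury form, conjunct 3 carries the B4 (1.13)/(1.14)/
  (3.6) attribution; A1 (what the rescaling (·)_L does) and A2 (`B10NestedMinimizer` wording) folded.  No declaration changed.

WHAT IS NOT REPRODUCED.  The Gaussian integrals themselves (volume factors (2π)^{·/2}, L^{s_N − s_{N−k−1}}), the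
rescaling 𝒜 ↦ 𝒜_L between steps (in (birthday) the j-th factor lives on the lattice 𝕋^{−j}), positivity of S + a_kQ_k^TQ_k
(«The inverse exists since this is a strictly positive operator», L702) — here invertibility is a hypothesis — and anything
about the δ-function-constrained GAUGE-field normalizations 𝒵_k of D5 §4.2 (sammy) / Bałaban's Z^{(j)}(U_k) ([Balaban1987RG1]
(1.3)–(1.4)), whose determinants are those of constrained forms CᵀΔ_kC (D5 §4.5) — the β sub-cell's (T1) item
(`Beta/OneShotTelescope`) names «Schur-complement multiplicativity of the δ-constrained Gaussian determinants» as the EASY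
part of its telescoping hypothesis; this file is that easy part for the Gaussian (δ_G) constraint only.  NOT summit progress.
-/

namespace Literature.MathematicalPhysics.QuantumFieldTheory.Dimock2015.NormTel

open Matrix

variable {n m p : Type*} [Fintype n] [Fintype m] [Fintype p] [DecidableEq n] [DecidableEq m] [DecidableEq p]

omit [DecidableEq m] in
/-- [folklore] `P = QᵀQ` is idempotent when `Q Qᵀ = 1` (Dimock L395–397 «Q(A)Q^T(A) = I and Q^T(A)Q(A) is an
orthogonal projection»). -/
theorem proj_idem (Q : Matrix p m ℝ) (hQ : Q * Qᵀ = 1) :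
    (Qᵀ * Q) * (Qᵀ * Q) = Qᵀ * Q := by
  rw [Matrix.mul_assoc, ← Matrix.mul_assoc Q Qᵀ Q, hQ, Matrix.one_mul]

/-- [folklore] Right inverse of `a•1 + b•P` for an idempotent `P`: `(a•1 + b•P)(a⁻¹(1 − P) + (a+b)⁻¹P) = 1`
(a ≠ 0, a + b ≠ 0).  This is Dimock's 𝒜_{k,x} formula (three)/(lamp) at x = 0:
«𝒜_k(𝒜) = (1/a_k)(I − Q^TQ(𝒜)) + (1/(a_k + aL^{−2})) Q^TQ(𝒜)» (L4238–4243). -/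
theorem resolvent_proj_mul (P : Matrix m m ℝ) (hP : P * P = P) {a b : ℝ} (ha : a ≠ 0) (hab : a + b ≠ 0) :
    (a • (1 : Matrix m m ℝ) + b • P) * (a⁻¹ • (1 - P) + (a + b)⁻¹ • P) = 1 := by
  have h1 : (a • (1 : Matrix m m ℝ) + b • P) * (a⁻¹ • (1 - P))
      = (1 : Matrix m m ℝ) - P := by
    rw [Matrix.add_mul, Matrix.smul_mul, Matrix.mul_smul, Matrix.one_mul, smul_smul, mul_inv_cancel₀ ha, one_smul,
      Matrix.smul_mul, Matrix.mul_smul, Matrix.mul_sub, Matrix.mul_one, hP, sub_self, smul_zero, smul_zero, add_zero]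
  have h2 : (a • (1 : Matrix m m ℝ) + b • P) * ((a + b)⁻¹ • P) = P := by
    rw [Matrix.add_mul, Matrix.smul_mul, Matrix.mul_smul, Matrix.one_mul, Matrix.smul_mul, Matrix.mul_smul, hP,
      smul_smul, smul_smul, ← add_smul, ← add_mul, mul_inv_cancel₀ hab, one_smul]
  rw [Matrix.mul_add, h1, h2, sub_add_cancel]

/-- [folklore] The same matrix is also a left inverse. -/
theorem mul_resolvent_proj (P : Matrix m m ℝ) (hP : P * P = P) {a b : ℝ} (ha : a ≠ 0) (hab : a + b ≠ 0) :
    (a⁻¹ • (1 - P) + (a + b)⁻¹ • P) * (a • (1 : Matrix m m ℝ) + b • P) = 1 := by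
  have h1 : (a⁻¹ • ((1 : Matrix m m ℝ) - P)) * (a • (1 : Matrix m m ℝ) + b • P)
      = (1 : Matrix m m ℝ) - P := by
    rw [Matrix.mul_add, Matrix.smul_mul, Matrix.mul_smul, Matrix.mul_one, smul_smul, inv_mul_cancel₀ ha, one_smul,
      Matrix.smul_mul, Matrix.mul_smul, Matrix.sub_mul, Matrix.one_mul, hP, sub_self, smul_zero, smul_zero, add_zero]
  have h2 : ((a + b)⁻¹ • P) * (a • (1 : Matrix m m ℝ) + b • P) = P := by
    rw [Matrix.mul_add, Matrix.smul_mul, Matrix.mul_smul, Matrix.mul_one, Matrix.smul_mul, Matrix.mul_smul, hP,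
      smul_smul, smul_smul, ← add_smul, ← mul_add, inv_mul_cancel₀ hab, one_smul]
  rw [Matrix.add_mul, h1, h2, sub_add_cancel]

/-- [folklore] The inverse of `a•1 + b•P`. -/
theorem inv_weight (P : Matrix m m ℝ) (hP : P * P = P) {a b : ℝ} (ha : a ≠ 0) (hab : a + b ≠ 0) :
    (a • (1 : Matrix m m ℝ) + b • P)⁻¹ = a⁻¹ • (1 - P) + (a + b)⁻¹ • P :=
  Matrix.inv_eq_right_inv (resolvent_proj_mul P hP ha hab)

omit [Fintype m] in
/-- [folklore] Schur complement of the TOP-LEFT block of Dimock's Hessian: with `A = S + a•QkᵀQk` invertible,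
`(a•1 + b•P) − (−a•Qk) A⁻¹ (−a•Qkᵀ) = (a•1 − a²•Qk A⁻¹ Qkᵀ) + b•P = Δ_k + aL^{−2}Q^TQ` = C_k⁻¹
(D5 (min1) L741–742 «C_k(𝒜) = (Δ_k(𝒜) + (a/L²)Q^T(𝒜)Q(𝒜))^{−1}»). -/
theorem schur_topLeft (A : Matrix n n ℝ) (Qk : Matrix m n ℝ) (P : Matrix m m ℝ) (a b : ℝ) :
    (a • (1 : Matrix m m ℝ) + b • P) - (-(a • Qk)) * A⁻¹ * (-(a • Qkᵀ))
      = (a • (1 : Matrix m m ℝ) - a ^ 2 • (Qk * A⁻¹ * Qkᵀ)) + b • P := by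
  rw [Matrix.neg_mul, Matrix.neg_mul, Matrix.mul_neg, neg_neg, Matrix.smul_mul, Matrix.smul_mul, Matrix.mul_smul,
    smul_smul, sq]
  abel

omit [Fintype n] [DecidableEq n] in
/-- [folklore] Schur complement of the BOTTOM-RIGHT block: with `P = QᵀQ`, `Q Qᵀ = 1`, a ≠ 0, a + b ≠ 0,
`A − (−a•Qkᵀ)(a•1 + b•P)⁻¹(−a•Qk) = S + (ab/(a+b))•(Q Qk)ᵀ(Q Qk)` — the COMPOSED fine operator G⁰_{k+1}(𝒜)⁻¹ of (lamp) L4238–4243: with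
b = aL^{−2} the coefficient ab/(a+b) is a_{k+1}·L^{−2}, «a_{k+1} = aa_k/(a_k + aL^{−2})» (L630) — (fifty)'s a_{k+1}/L²
before the rescaling (queen3). -/
theorem schur_bottomRight (S : Matrix n n ℝ) (Qk : Matrix m n ℝ) (Q : Matrix p m ℝ) (hQ : Q * Qᵀ = 1)
    {a b : ℝ} (ha : a ≠ 0) (hab : a + b ≠ 0) :
    (S + a • (Qkᵀ * Qk)) - (-(a • Qkᵀ)) * (a • (1 : Matrix m m ℝ) + b • (Qᵀ * Q))⁻¹ * (-(a • Qk))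
      = S + (a * b / (a + b)) • ((Q * Qk)ᵀ * (Q * Qk)) := by
  rw [inv_weight (Qᵀ * Q) (proj_idem Q hQ) ha hab]
  set P : Matrix m m ℝ := Qᵀ * Q with hPdef
  set E : Matrix m m ℝ := a⁻¹ • (1 - P) + (a + b)⁻¹ • P with hEdef
  -- pull the scalars out of the sandwich
  have hpull : (-(a • Qkᵀ)) * E * (-(a • Qk)) = a ^ 2 • (Qkᵀ * E * Qk) := by
    rw [Matrix.neg_mul, Matrix.neg_mul, Matrix.mul_neg, neg_neg, Matrix.smul_mul, Matrix.smul_mul, Matrix.mul_smul,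
      smul_smul, sq]
  -- expand the middle
  have hmid : Qkᵀ * E * Qk = a⁻¹ • (Qkᵀ * Qk) - a⁻¹ • (Qkᵀ * P * Qk) + (a + b)⁻¹ • (Qkᵀ * P * Qk) := by
    rw [hEdef, Matrix.mul_add, Matrix.mul_smul, Matrix.mul_smul, Matrix.add_mul, Matrix.smul_mul, Matrix.smul_mul,
      Matrix.mul_sub, Matrix.mul_one, Matrix.sub_mul, smul_sub]
  have hXPY : Qkᵀ * P * Qk = (Q * Qk)ᵀ * (Q * Qk) := by
    rw [hPdef, Matrix.transpose_mul]
    simp only [Matrix.mul_assoc]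
  rw [hpull, hmid, hXPY, smul_add, smul_sub, smul_smul, smul_smul, smul_smul]
  have h1 : a ^ 2 * a⁻¹ = a := by rw [sq, mul_assoc, mul_inv_cancel₀ ha, mul_one]
  rw [h1]
  have hcoef : a * b / (a + b) = a - a ^ 2 * (a + b)⁻¹ := by
    field_simp
    ring
  rw [hcoef, sub_smul]
  abel

/-- [folklore] THE ONE-STEP DETERMINANT IDENTITY (Dimock (z) L789–790 / the j-th factor of (birthday) L4138–4141, without the
volume and 2π bookkeeping): for `A = S + a•QkᵀQk` with `det A ≠ 0`, `Q Qᵀ = 1`, `a ≠ 0`, `a + b ≠ 0`,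
`det A · det(Δ_k + b•QᵀQ) = det(a•1 + b•QᵀQ) · det(S + (ab/(a+b))•(Q Qk)ᵀ(Q Qk))`,
`Δ_k = a•1 − a²•Qk A⁻¹ Qkᵀ`.  Proof: both sides equal `det (fromBlocks A (−a•Qkᵀ) (−a•Qk) (a•1 + b•QᵀQ))`
(`Matrix.det_fromBlocks₁₁` and `Matrix.det_fromBlocks₂₂`). -/
theorem det_oneStep (S : Matrix n n ℝ) (Qk : Matrix m n ℝ) (Q : Matrix p m ℝ) (hQ : Q * Qᵀ = 1)
    {a b : ℝ} (ha : a ≠ 0) (hab : a + b ≠ 0) (hA : (S + a • (Qkᵀ * Qk)).det ≠ 0) :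
    (S + a • (Qkᵀ * Qk)).det
        * ((a • (1 : Matrix m m ℝ) - a ^ 2 • (Qk * (S + a • (Qkᵀ * Qk))⁻¹ * Qkᵀ)) + b • (Qᵀ * Q)).det
      = (a • (1 : Matrix m m ℝ) + b • (Qᵀ * Q)).det * (S + (a * b / (a + b)) • ((Q * Qk)ᵀ * (Q * Qk))).det := by
  have hAu : IsUnit (S + a • (Qkᵀ * Qk)).det := isUnit_iff_ne_zero.mpr hA
  letI : Invertible (S + a • (Qkᵀ * Qk)) := Matrix.invertibleOfIsUnitDet _ hAu
  letI : Invertible (a • (1 : Matrix m m ℝ) + b • (Qᵀ * Q)) :=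
    invertibleOfRightInverse _ _ (resolvent_proj_mul (Qᵀ * Q) (proj_idem Q hQ) ha hab)
  have h11 := Matrix.det_fromBlocks₁₁ (S + a • (Qkᵀ * Qk)) (-(a • Qkᵀ)) (-(a • Qk))
    (a • (1 : Matrix m m ℝ) + b • (Qᵀ * Q))
  have h22 := Matrix.det_fromBlocks₂₂ (S + a • (Qkᵀ * Qk)) (-(a • Qkᵀ)) (-(a • Qk))
    (a • (1 : Matrix m m ℝ) + b • (Qᵀ * Q))
  rw [Matrix.invOf_eq_nonsing_inv] at h11 h22
  rw [schur_topLeft] at h11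
  rw [schur_bottomRight S Qk Q hQ ha hab] at h22
  exact h11.symm.trans h22

/-- [folklore] Sylvester's determinant count for the weight block: `det(a•1_m + b•QᵀQ) = a^(card m − card p) · (a+b)^(card p)`
when `Q Qᵀ = 1_p` (so `card p ≤ card m`).  In Dimock's recursion this is the background-INDEPENDENT constant (the N_k-type
factor), which is why it drops out of the ratio (birthday). -/
theorem det_weight (Q : Matrix p m ℝ) (hQ : Q * Qᵀ = 1) {a : ℝ} (ha : a ≠ 0) (b : ℝ)
    (hcard : Fintype.card p ≤ Fintype.card m) :
    (a • (1 : Matrix m m ℝ) + b • (Qᵀ * Q)).det = a ^ (Fintype.card m - Fintype.card p) * (a + b) ^ Fintype.card p := by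
  have hfac : a • (1 : Matrix m m ℝ) + b • (Qᵀ * Q) = a • ((1 : Matrix m m ℝ) + ((a⁻¹ * b) • Qᵀ) * Q) := by
    rw [smul_add, Matrix.smul_mul, smul_smul, ← mul_assoc, mul_inv_cancel₀ ha, one_mul]
  rw [hfac, Matrix.det_smul, Matrix.det_one_add_mul_comm, Matrix.mul_smul, hQ]
  have hdiag : ((1 : Matrix p p ℝ) + (a⁻¹ * b) • (1 : Matrix p p ℝ)).det = (1 + a⁻¹ * b) ^ Fintype.card p := by
    have hs : (1 : Matrix p p ℝ) + (a⁻¹ * b) • (1 : Matrix p p ℝ) = (1 + a⁻¹ * b) • (1 : Matrix p p ℝ) := by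
      rw [add_smul, one_smul]
    rw [hs, Matrix.det_smul, Matrix.det_one, mul_one]
  rw [hdiag]
  have hsplit : a ^ Fintype.card m = a ^ (Fintype.card m - Fintype.card p) * a ^ Fintype.card p := by
    rw [← pow_add, Nat.sub_add_cancel hcard]
  rw [hsplit, mul_assoc, ← mul_pow]
  congr 2
  field_simp

/-- [folklore] One factor of (birthday): for two «backgrounds» S₁, S₂ (same averaging data), the constant `det(a•1 + b•P)` cancels:
`det A₁' · (det A₂ · det Cinv₂) = det A₂' · (det A₁ · det Cinv₁)`, i.e. det G'₂/det G'₁ = (det G₂/det G₁)·(det C₂/det C₁)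
in Dimock's inverse notation. -/
theorem det_ratio_oneStep (S₁ S₂ : Matrix n n ℝ) (Qk : Matrix m n ℝ) (Q : Matrix p m ℝ) (hQ : Q * Qᵀ = 1)
    {a b : ℝ} (ha : a ≠ 0) (hab : a + b ≠ 0)
    (h₁ : (S₁ + a • (Qkᵀ * Qk)).det ≠ 0) (h₂ : (S₂ + a • (Qkᵀ * Qk)).det ≠ 0) :
    (S₁ + (a * b / (a + b)) • ((Q * Qk)ᵀ * (Q * Qk))).det
        * ((S₂ + a • (Qkᵀ * Qk)).det
          * ((a • (1 : Matrix m m ℝ) - a ^ 2 • (Qk * (S₂ + a • (Qkᵀ * Qk))⁻¹ * Qkᵀ)) + b • (Qᵀ * Q)).det)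
      = (S₂ + (a * b / (a + b)) • ((Q * Qk)ᵀ * (Q * Qk))).det
        * ((S₁ + a • (Qkᵀ * Qk)).det
          * ((a • (1 : Matrix m m ℝ) - a ^ 2 • (Qk * (S₁ + a • (Qkᵀ * Qk))⁻¹ * Qkᵀ)) + b • (Qᵀ * Q)).det) := by
  rw [det_oneStep S₂ Qk Q hQ ha hab h₂, det_oneStep S₁ Qk Q hQ ha hab h₁]
  ring

/-- [folklore] The k-step bookkeeping of (birthday): a sequence with `r (j+1) = r j * c j` telescopes to a product. -/
theorem normalization_telescope (r c : ℕ → ℝ) (h : ∀ j, r (j + 1) = r j * c j) (k : ℕ) :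
    r k = r 0 * ∏ j ∈ Finset.range k, c j := by
  induction k with
  | zero => simp
  | succ k ih => rw [h k, ih, Finset.prod_range_succ, mul_assoc]


/-! ## v1.1 (append-only): the INVERSE of the same block matrix — three more printed identities at once

Inverting Dimock's Hessian block matrix `M = fromBlocks A (−a•Qkᵀ) (−a•Qk) (a•1 + b•P)` in the two Schur orders
(`Matrix.invOf_fromBlocks₁₁_eq` / `Matrix.invOf_fromBlocks₂₂_eq`) and comparing blocks gives, with G := A⁻¹ (= G_k(𝒜)),
C := (Δ + b•P)⁻¹ (= C_k(𝒜)), E := (a•1 + b•P)⁻¹ (= 𝒜_k, (lamp)), G′ := A′⁻¹ (= G⁰_{k+1}(𝒜), the composed fine propagator):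
* top-left (conjunct 1 of `blockInv_eq`):  G′ = G + a²•G Qkᵀ C Qk G      — the Woodbury form of the composed propagator; [folklore],
  NOT a printed display (B4 p.588 (3.6) prints the OTHER Schur order = conjunct 3's shape, (3.9) is a resolvent difference
  G_k(Ω,Λ,A) − G^η_{k+1}(Ω,A); nothing of this shape in D1/D5 — hostile XREAD ref6-g15, REFEREE6.md E83); abstract-ring sibling:
  tree `Beta/ScaleTransport.nextProp_eq`;
* bottom-right (conjunct 3 of `blockInv_eq`):  C = E + a²•E Qk G′ Qkᵀ E       — Dimock (lamp) L4238–4243 «C_k(𝒜) = 𝒜_k(𝒜) + a_k²𝒜_k(𝒜)Q_k(𝒜)G⁰_{k+1}(𝒜)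
  Q_k^T(𝒜)𝒜_k(𝒜)» = D1 (coin) = [Balaban1983Decay] B4 p.573 (1.13) «C^{(k)}_Λ(Ω,A) = ((Δ^{(k)}(Ω,A) + aL^{−2}P(A))|_Λ)^{−1}», (1.14)
  «Δ^{(k)}(Ω,A) = a_kI − a_k²Q_k(A)G_k(Ω,A)Q_k^*(A)» written through the composed-scale propagator G_k(Ω,Λ,A) of (3.5): p.588 (3.6)
  at Λ = Ω (render p018 read as image; E·(a_kQ_k) = Q_k − (a_{k+1}/a_k)L^{−2}Q^*Q_{k+1} and E = δ/a_k − (a_{k+1}/a_k²)L^{−2}P are (3.6)'s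
  brackets and local terms, a_{k+1}L^{−2}/a_k = b/(a_k + b)); abstract-ring sibling `Beta/ScaleTransport.fluctCov_eq`;
* off-diagonal (conjunct 2 of `blockInv_eq`) and its consequence **`minimizer_compose`**: (a•G Qkᵀ)·(b•C Qᵀ) = (ab/(a+b))•G′(Q Qk)ᵀ, i.e.
  ℋ_k(𝒜)·H_k(𝒜) = (a_{k+1}/L²)G⁰_{k+1}Q_{k+1}^T, = ℋ_{k+1} up to the rescaling (queen3)/(·)_L (under (·)_L the operator
  −Δ_{𝒜_L} + (a_{k+1}/L²)Q_{k+1}^TQ_{k+1} on 𝕋^{−k−1}_{N−k−1} corresponds to L^{−2}(−Δ_𝒜 + a_{k+1}Q_{k+1}^TQ_{k+1}) one scale up, so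
  G⁰_{k+1}(𝒜_L) ↔ L²·G_{k+1}(𝒜) and the L^{−2} of the coefficient cancels — this rescaling step is the content of (h) itself and is
  NOT reproduced here) — Dimock (h) L807–809 «ℋ_k(𝒜_L)H_k(𝒜_L)Φ_{k+1,L} = (ℋ_{k+1}(𝒜)Φ_{k+1})_L» with
  ℋ_k = a_kG_kQ_k^T (L695–697) and H_k = (a/L²)C_kQ^T (min1) L737–739; for the gauge field (sammy) L1613–1617 «(ℋ^x_{k+1}A_{k+1})_L = ℋ^x_kH^x_kA_{k+1,L}»;
  the linear-algebra core of the NESTING of minimisers ([Balaban1985UV3] = B10 (52), tree `B10NestedMinimizer` — there as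
  schematic bookkeeping over named leaves (StepData), no Gaussian formula; here the explicit Gaussian formula).
Hypotheses: QQᵀ = 1, a ≠ 0, a + b ≠ 0, det A ≠ 0, det(Δ + b•P) ≠ 0 (then det A′ ≠ 0 follows from `det_oneStep`). [folklore]. -/

omit [DecidableEq m] in
/-- [folklore] `P Qᵀ = Qᵀ` for `P = QᵀQ`, `Q Qᵀ = 1`. -/
theorem proj_mul_transpose (Q : Matrix p m ℝ) (hQ : Q * Qᵀ = 1) : (Qᵀ * Q) * Qᵀ = Qᵀ := by
  rw [Matrix.mul_assoc, hQ, Matrix.mul_one]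

/-- [folklore] `(a•1 + b•P)⁻¹ Qᵀ = (a+b)⁻¹ • Qᵀ` — the averaging constraint direction sees the full weight a + b. -/
theorem inv_weight_mul_transpose (Q : Matrix p m ℝ) (hQ : Q * Qᵀ = 1) {a b : ℝ} (ha : a ≠ 0) (hab : a + b ≠ 0) :
    (a • (1 : Matrix m m ℝ) + b • (Qᵀ * Q))⁻¹ * Qᵀ = (a + b)⁻¹ • Qᵀ := by
  rw [inv_weight (Qᵀ * Q) (proj_idem Q hQ) ha hab, Matrix.add_mul, Matrix.smul_mul, Matrix.smul_mul,
    Matrix.sub_mul, Matrix.one_mul, proj_mul_transpose Q hQ, sub_self, smul_zero, zero_add]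

/-- [folklore] The two Schur-order inverses of Dimock's Hessian block matrix agree block by block.  With
`A = S + a•QkᵀQk`, `D = a•1 + b•QᵀQ`, `Cinv = (a•1 − a²•Qk A⁻¹ Qkᵀ) + b•QᵀQ`, `A′ = S + (ab/(a+b))•(QQk)ᵀ(QQk)`:
(top-left) `A′⁻¹ = A⁻¹ + A⁻¹(−a•Qkᵀ)Cinv⁻¹(−a•Qk)A⁻¹`, (off-diagonal) `A⁻¹(−a•Qkᵀ)Cinv⁻¹ = A′⁻¹(−a•Qkᵀ)D⁻¹`,
(bottom-right) `Cinv⁻¹ = D⁻¹ + D⁻¹(−a•Qk)A′⁻¹(−a•Qkᵀ)D⁻¹`. -/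
theorem blockInv_eq (S : Matrix n n ℝ) (Qk : Matrix m n ℝ) (Q : Matrix p m ℝ) (hQ : Q * Qᵀ = 1)
    {a b : ℝ} (ha : a ≠ 0) (hab : a + b ≠ 0) (hA : (S + a • (Qkᵀ * Qk)).det ≠ 0)
    (hC : ((a • (1 : Matrix m m ℝ) - a ^ 2 • (Qk * (S + a • (Qkᵀ * Qk))⁻¹ * Qkᵀ)) + b • (Qᵀ * Q)).det ≠ 0) :
    (S + (a * b / (a + b)) • ((Q * Qk)ᵀ * (Q * Qk)))⁻¹
        = (S + a • (Qkᵀ * Qk))⁻¹ + (S + a • (Qkᵀ * Qk))⁻¹ * (-(a • Qkᵀ))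
            * ((a • (1 : Matrix m m ℝ) - a ^ 2 • (Qk * (S + a • (Qkᵀ * Qk))⁻¹ * Qkᵀ)) + b • (Qᵀ * Q))⁻¹
            * (-(a • Qk)) * (S + a • (Qkᵀ * Qk))⁻¹
      ∧ (S + a • (Qkᵀ * Qk))⁻¹ * (-(a • Qkᵀ))
            * ((a • (1 : Matrix m m ℝ) - a ^ 2 • (Qk * (S + a • (Qkᵀ * Qk))⁻¹ * Qkᵀ)) + b • (Qᵀ * Q))⁻¹
        = (S + (a * b / (a + b)) • ((Q * Qk)ᵀ * (Q * Qk)))⁻¹ * (-(a • Qkᵀ))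
            * (a • (1 : Matrix m m ℝ) + b • (Qᵀ * Q))⁻¹
      ∧ ((a • (1 : Matrix m m ℝ) - a ^ 2 • (Qk * (S + a • (Qkᵀ * Qk))⁻¹ * Qkᵀ)) + b • (Qᵀ * Q))⁻¹
        = (a • (1 : Matrix m m ℝ) + b • (Qᵀ * Q))⁻¹ + (a • (1 : Matrix m m ℝ) + b • (Qᵀ * Q))⁻¹ * (-(a • Qk))
            * (S + (a * b / (a + b)) • ((Q * Qk)ᵀ * (Q * Qk)))⁻¹ * (-(a • Qkᵀ))
            * (a • (1 : Matrix m m ℝ) + b • (Qᵀ * Q))⁻¹ := by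
  -- names
  set A : Matrix n n ℝ := S + a • (Qkᵀ * Qk) with hAdef
  set D : Matrix m m ℝ := a • (1 : Matrix m m ℝ) + b • (Qᵀ * Q) with hDdef
  set B : Matrix n m ℝ := -(a • Qkᵀ) with hBdef
  set Cm : Matrix m n ℝ := -(a • Qk) with hCdef
  set Cinv : Matrix m m ℝ := (a • (1 : Matrix m m ℝ) - a ^ 2 • (Qk * A⁻¹ * Qkᵀ)) + b • (Qᵀ * Q) with hCinvdef
  set A' : Matrix n n ℝ := S + (a * b / (a + b)) • ((Q * Qk)ᵀ * (Q * Qk)) with hA'def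
  -- invertibility of the four relevant matrices
  have hAu : IsUnit A.det := isUnit_iff_ne_zero.mpr hA
  letI iA : Invertible A := Matrix.invertibleOfIsUnitDet A hAu
  letI iD : Invertible D := invertibleOfRightInverse D _ (resolvent_proj_mul (Qᵀ * Q) (proj_idem Q hQ) ha hab)
  have hS1 : D - Cm * ⅟A * B = Cinv := by
    rw [Matrix.invOf_eq_nonsing_inv, hDdef, hCdef, hBdef, hCinvdef]
    exact schur_topLeft A Qk (Qᵀ * Q) a b
  have hS2 : A - B * ⅟D * Cm = A' := by
    rw [Matrix.invOf_eq_nonsing_inv, hAdef, hBdef, hDdef, hCdef, hA'def]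
    exact schur_bottomRight S Qk Q hQ ha hab
  have hCu : IsUnit Cinv.det := isUnit_iff_ne_zero.mpr hC
  letI iS1 : Invertible (D - Cm * ⅟A * B) := (Matrix.invertibleOfIsUnitDet Cinv hCu).copy _ hS1
  -- det A' ≠ 0 from the determinant identity
  have hdet := det_oneStep S Qk Q hQ ha hab hA
  have hDdet : D.det ≠ 0 := by
    intro h0
    have := congrArg Matrix.det (resolvent_proj_mul (Qᵀ * Q) (proj_idem Q hQ) ha hab)
    rw [Matrix.det_mul, ← hDdef, h0, zero_mul, Matrix.det_one] at this
    exact zero_ne_one this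
  have hA'det : A'.det ≠ 0 := by
    intro h0
    rw [← hAdef, ← hCinvdef, ← hDdef, ← hA'def, h0, mul_zero] at hdet
    exact (mul_ne_zero hA hC) hdet
  have hA'u : IsUnit A'.det := isUnit_iff_ne_zero.mpr hA'det
  letI iS2 : Invertible (A - B * ⅟D * Cm) := (Matrix.invertibleOfIsUnitDet A' hA'u).copy _ hS2
  letI iM : Invertible (Matrix.fromBlocks A B Cm D) := Matrix.fromBlocks₁₁Invertible A B Cm D
  have e1 := Matrix.invOf_fromBlocks₁₁_eq A B Cm D
  have e2 := Matrix.invOf_fromBlocks₂₂_eq A B Cm D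
  have e := e1.symm.trans e2
  rw [Matrix.fromBlocks_inj] at e
  obtain ⟨e11, e12, _, e22⟩ := e
  -- replace every ⅟ by the nonsingular inverse and the Schur complements by their closed forms
  have iAe : ⅟A = A⁻¹ := Matrix.invOf_eq_nonsing_inv A
  have iDe : ⅟D = D⁻¹ := Matrix.invOf_eq_nonsing_inv D
  have iS1e : ⅟(D - Cm * ⅟A * B) = Cinv⁻¹ := by
    rw [Matrix.invOf_eq_nonsing_inv]; exact congrArg _ hS1
  have iS2e : ⅟(A - B * ⅟D * Cm) = A'⁻¹ := by
    rw [Matrix.invOf_eq_nonsing_inv]; exact congrArg _ hS2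
  rw [iS1e, iS2e] at e11 e12 e22
  rw [iAe] at e11 e12
  rw [iDe] at e12 e22
  refine ⟨e11.symm, ?_, e22⟩
  have := e12
  rw [neg_inj] at this
  exact this

/-- [folklore] THE MINIMISER COMPOSITION (Dimock (h), TeX L807–809; gauge-field form (sammy) L1613–1617; B10 (52)'s Gaussian core):
`(a•A⁻¹Qkᵀ)·(b•Cinv⁻¹Qᵀ) = (ab/(a+b))•A′⁻¹(QQk)ᵀ`, i.e. ℋ_k·H_k = ℋ_{k+1} with ℋ_k = a_kG_kQ_kᵀ (L695–697), H_k = (a/L²)C_kQᵀ (L737–739);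
the right side is (a_{k+1}/L²)·G⁰_{k+1}·Q_{k+1}ᵀ — ab/(a+b) = a_{k+1}L^{−2} for b = aL^{−2}, «a_{k+1} = aa_k/(a_k + aL^{−2})» (L630),
G⁰_{k+1} = A′⁻¹ ((lamp) L4238–4243), Q_{k+1} = QQ_k — which the rescaling (queen3)/(·)_L turns into ℋ_{k+1} = a_{k+1}G_{k+1}Q_{k+1}ᵀ. -/
theorem minimizer_compose (S : Matrix n n ℝ) (Qk : Matrix m n ℝ) (Q : Matrix p m ℝ) (hQ : Q * Qᵀ = 1)
    {a b : ℝ} (ha : a ≠ 0) (hab : a + b ≠ 0) (hA : (S + a • (Qkᵀ * Qk)).det ≠ 0)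
    (hC : ((a • (1 : Matrix m m ℝ) - a ^ 2 • (Qk * (S + a • (Qkᵀ * Qk))⁻¹ * Qkᵀ)) + b • (Qᵀ * Q)).det ≠ 0) :
    (a • ((S + a • (Qkᵀ * Qk))⁻¹ * Qkᵀ))
        * (b • (((a • (1 : Matrix m m ℝ) - a ^ 2 • (Qk * (S + a • (Qkᵀ * Qk))⁻¹ * Qkᵀ)) + b • (Qᵀ * Q))⁻¹ * Qᵀ))
      = (a * b / (a + b)) • ((S + (a * b / (a + b)) • ((Q * Qk)ᵀ * (Q * Qk)))⁻¹ * (Q * Qk)ᵀ) := by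
  obtain ⟨_, e12, _⟩ := blockInv_eq S Qk Q hQ ha hab hA hC
  set A : Matrix n n ℝ := S + a • (Qkᵀ * Qk) with hAdef
  set D : Matrix m m ℝ := a • (1 : Matrix m m ℝ) + b • (Qᵀ * Q) with hDdef
  set Cinv : Matrix m m ℝ := (a • (1 : Matrix m m ℝ) - a ^ 2 • (Qk * A⁻¹ * Qkᵀ)) + b • (Qᵀ * Q) with hCinvdef
  set A' : Matrix n n ℝ := S + (a * b / (a + b)) • ((Q * Qk)ᵀ * (Q * Qk)) with hA'def
  -- e12 : A⁻¹ (−a•Qkᵀ) Cinv⁻¹ = A'⁻¹ (−a•Qkᵀ) D⁻¹ ; strip the sign and the scalar a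
  have key : A⁻¹ * Qkᵀ * Cinv⁻¹ = A'⁻¹ * Qkᵀ * D⁻¹ := by
    have h := e12
    simp only [Matrix.mul_neg, Matrix.neg_mul, Matrix.mul_smul, Matrix.smul_mul, neg_inj] at h
    have h' := congrArg (fun X : Matrix n m ℝ => a⁻¹ • X) h
    simp only [smul_smul, inv_mul_cancel₀ ha, one_smul] at h'
    exact h'
  have hD : D⁻¹ * Qᵀ = (a + b)⁻¹ • Qᵀ := by
    rw [hDdef]; exact inv_weight_mul_transpose Q hQ ha hab
  calc (a • (A⁻¹ * Qkᵀ)) * (b • (Cinv⁻¹ * Qᵀ))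
      = (a * b) • (A⁻¹ * Qkᵀ * Cinv⁻¹ * Qᵀ) := by
        rw [Matrix.smul_mul, Matrix.mul_smul, smul_smul, ← Matrix.mul_assoc]
    _ = (a * b) • (A'⁻¹ * Qkᵀ * D⁻¹ * Qᵀ) := by rw [key]
    _ = (a * b) • (A'⁻¹ * Qkᵀ * ((a + b)⁻¹ • Qᵀ)) := by rw [Matrix.mul_assoc (A'⁻¹ * Qkᵀ) D⁻¹ Qᵀ, hD]
    _ = (a * b / (a + b)) • (A'⁻¹ * (Q * Qk)ᵀ) := by
        rw [Matrix.mul_smul, smul_smul, Matrix.transpose_mul, Matrix.mul_assoc, div_eq_mul_inv]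

/-! ## v1.3 (append-only): the cardinality hypothesis of `det_weight` is automatic -/

omit [DecidableEq m] in
/-- [folklore] `Q Qᵀ = 1` forces `card p ≤ card m` (rank count: card p = rank 1 = rank (Q Qᵀ) ≤ rank Q ≤ card m), so the
hypothesis `hcard` of `det_weight` is automatic (remark of the hostile XREAD adv1-g25, C-A30-1 (ii)). -/
theorem card_le_of_mul_transpose_eq_one (Q : Matrix p m ℝ) (hQ : Q * Qᵀ = 1) : Fintype.card p ≤ Fintype.card m := by
  have h1 : (1 : Matrix p p ℝ).rank = Fintype.card p := Matrix.rank_one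
  have h2 : (Q * Qᵀ).rank ≤ Q.rank := Matrix.rank_mul_le_left Q Qᵀ
  rw [hQ, h1] at h2
  exact h2.trans (Matrix.rank_le_card_width Q)

/-- [folklore] `det_weight` without the cardinality hypothesis: det(a•1_m + b•QᵀQ) = a^(card m − card p)·(a + b)^(card p) for
`Q Qᵀ = 1`, `a ≠ 0` — Dimock's background-independent constant in (z) (the N_k-type factor), absent from the ratio (birthday). -/
theorem det_weight' (Q : Matrix p m ℝ) (hQ : Q * Qᵀ = 1) {a : ℝ} (ha : a ≠ 0) (b : ℝ) :
    (a • (1 : Matrix m m ℝ) + b • (Qᵀ * Q)).det = a ^ (Fintype.card m - Fintype.card p) * (a + b) ^ Fintype.card p :=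
  det_weight Q hQ ha b (card_le_of_mul_transpose_eq_one Q hQ)

/-- [folklore] Hence the weight block `a•1 + b•QᵀQ` has non-zero determinant when `Q Qᵀ = 1`, `a ≠ 0`, `a + b ≠ 0`
(the invertibility that `schur_topLeft`/`det_oneStep` obtain from `resolvent_proj_mul`, now as a determinant statement). -/
theorem det_weight_ne_zero (Q : Matrix p m ℝ) (hQ : Q * Qᵀ = 1) {a b : ℝ} (ha : a ≠ 0) (hab : a + b ≠ 0) :
    (a • (1 : Matrix m m ℝ) + b • (Qᵀ * Q)).det ≠ 0 := by
  rw [det_weight' Q hQ ha b]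
  exact mul_ne_zero (pow_ne_zero _ ha) (pow_ne_zero _ hab)

end Literature.MathematicalPhysics.QuantumFieldTheory.Dimock2015.NormTel
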